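import Summits.Parity.GeneralizedHardyLittlewood.Theorems.BeyondDiagonalBeatsQuarter.OffDiagDualCostBoxSwap
import Summits.Parity.GeneralizedHardyLittlewood.Theorems.BeyondDiagonalBeatsQuarter.OffDiagDualTruncationPure
import HarnessLib

/-!
# Route `PrimeLevelFamEdge`, crux K_B (stmt-Parity-20343), line `diagonal_kernel_split` rev 4, plan Ω,
# lemma **L2 — the dual truncation of one box weight, fully explicit** (L2c assembled)

For d5's box weight `Φ_i = OffDiag.boxWeight q d₁ d₂ α β r i` (`q, d₁, d₂, α, β ≥ 1`, `K_j = 2^{i_j}`) and any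
`c > 0` (downstream `c = qr`): the pure derivative costs of steps 7–8 (`OffDiagDualCostBoxIntegral`,
`OffDiagDualCostBoxSwap`) fed into the pure-cost truncation `tsum_tail_norm_fourier2_le_pure_of_cost`
(`OffDiagDualTruncationPure`) give, for every `k ≥ 2`, loss factor `Q ≥ 1` and truncation point
`H ≥ max(1, c·D₁·Q/(2π))`:

  `Σ_{h ∈ ℤ², |h₁| > H} ‖Φ̂_i(h₁/c, h₂/c)‖ ≤ 2·(S₁(k) + (π²/3)·(cD₂/(2π))²·√(S₁(2k)·S₂)) · H · Q^{−k}`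

(**`tsum_tail_norm_fourier2_boxWeight_le`**), where `D₁ = (1+Z)/(K₁/2)`, `D₂ = (1+Z)/(K₂/2)` are the
per-derivative costs (`Z` the box value of the Bessel scale `4π√(αβy₁y₂)/(qr)`) and `S₁(m)`, `S₂` the explicit
box sizes of steps 7–8 (polynomial in `K₁, K₂, d, r⁻¹`, independent of `q` otherwise). This is OMEGA-BLUEPRINT §3 L2
for the `h₁`-direction; the `h₂`-direction is the same statement for the swapped weight (`boxWeight_swap`,
`fourier2_transpose_of_contDiff`). Multiplicities `N ≤ N₀` enter through `tsum_tail_norm_fourier2_mul_le_of_cost`'s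
pattern (bounded weights). PROVED; theorems only. Helper; closes nothing.
«The programme SEARCHES and TYPES; no claim about Landau–Siegel zeros, Theorems 1–2 of arXiv:2211.02515 or
a repaired Margin232 until a kernel theorem says so.»
-/

noncomputable section

open Real Set Finset MeasureTheory
open scoped Topology ContDiff Nat FourierTransform

namespace Summit.Parity.GeneralizedHardyLittlewood.Theorems.BeyondDiagonalBeatsQuarter.OffDiagPoissonTwisted

open Literature.Analysis.FunctionSpaces Literature.NumberTheory.LFunctions.KMV2000
open Literature.NumberTheory.Sieve.FriedlanderIwaniecPrimes (fourier2)
open Literature.Analysis.Calculus.WhitneyConvex (dyadicBump dyadicBumpBound dyadicBumpBound_nonneg)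
open OffDiag (boxWeight contDiff_uncurry_boxWeight hasCompactSupport_uncurry_boxWeight)

section Assembly

variable {q d₁ d₂ α β r : ℕ}

/-- **L2 for one box weight, explicit.** For `q, d₁, d₂, α, β ≥ 1`, a box `i`, `c > 0`, `k ≥ 2`, a loss factor
`Q ≥ 1` and a truncation point `H ≥ 1` with `c·D₁·Q/(2π) ≤ H` (`D₁ = (1+Z)/(K₁/2)` the per-derivative cost):
`Σ_{h ∈ ℤ², |h₁| > H} ‖Φ̂_i(h₁/c,h₂/c)‖ ≤ 2·(S₁(k) + (π²/3)(cD₂/(2π))²√(S₁(2k)·S₂))·H·Q^{−k}`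
with the explicit box sizes `S₁(m)`, `S₂` and cost `D₂` of steps 7–8. [folklore] -/
theorem tsum_tail_norm_fourier2_boxWeight_le [NeZero q] (hd₁ : 1 ≤ d₁) (hd₂ : 1 ≤ d₂) (hα : 1 ≤ α)
    (hβ : 1 ≤ β) (i : ℕ × ℕ) {c : ℝ} (hc : 0 < c) {k H : ℕ} (hk : 2 ≤ k) (hH : 1 ≤ H) {Q : ℝ} (hQ : 1 ≤ Q)
    (hlen : c * ((1 + 4 * π * Real.sqrt ((α : ℝ) * β * (2 * 2 ^ i.2)) / ((q : ℝ) * r) * Real.sqrt (2 * 2 ^ i.1)) /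
            ((2 : ℝ) ^ i.1 / 2)) / (2 * π) * Q ≤ H) :
    ∑' h : ℤ × ℤ, (if (H : ℤ) < |h.1| then
        ‖fourier2 (boxWeight q d₁ d₂ α β r i) (h.1 / c) (h.2 / c)‖ else 0) ≤
      2 * (((3 * 2 ^ i.2 / 2) * (3 * 2 ^ i.1 / 2) *
            (∑ j ∈ Finset.range (k + 1), ((k : ℕ).choose j : ℝ) * (2 ^ j * dyadicBumpBound j) *
              ((((k - j : ℕ) : ℝ) + 1) ^ 2 * (k - j) ! * ((k - j : ℕ) : ℝ) ^ (k - j))) *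
            (((d₁ : ℝ) * d₂ * (2 ^ i.2 / 2)) ^ (-(1 : ℝ) / 2) * (r : ℝ)⁻¹ * ((2 : ℝ) ^ i.1 / 2) ^ (-(1 : ℝ) / 2))) +
          π ^ 2 / 3 * (c * ((1 + 4 * π * Real.sqrt ((β : ℝ) * α * (2 * 2 ^ i.1)) / ((q : ℝ) * r) * Real.sqrt (2 * 2 ^ i.2)) /
            ((2 : ℝ) ^ i.2 / 2)) / (2 * π)) ^ 2 *
            Real.sqrt (((3 * 2 ^ i.2 / 2) * (3 * 2 ^ i.1 / 2) *
            (∑ j ∈ Finset.range ((2 * k) + 1), (((2 * k) : ℕ).choose j : ℝ) * (2 ^ j * dyadicBumpBound j) *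
              (((((2 * k) - j : ℕ) : ℝ) + 1) ^ 2 * ((2 * k) - j) ! * (((2 * k) - j : ℕ) : ℝ) ^ ((2 * k) - j))) *
            (((d₁ : ℝ) * d₂ * (2 ^ i.2 / 2)) ^ (-(1 : ℝ) / 2) * (r : ℝ)⁻¹ * ((2 : ℝ) ^ i.1 / 2) ^ (-(1 : ℝ) / 2))) *
              ((3 * 2 ^ i.1 / 2) * (3 * 2 ^ i.2 / 2) *
            (∑ j ∈ Finset.range (4 + 1), ((4 : ℕ).choose j : ℝ) * (2 ^ j * dyadicBumpBound j) *
              ((((4 - j : ℕ) : ℝ) + 1) ^ 2 * (4 - j) ! * ((4 - j : ℕ) : ℝ) ^ (4 - j))) *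
            (((d₂ : ℝ) * d₁ * (2 ^ i.1 / 2)) ^ (-(1 : ℝ) / 2) * (r : ℝ)⁻¹ * ((2 : ℝ) ^ i.2 / 2) ^ (-(1 : ℝ) / 2))))) * H * (Q ^ k)⁻¹ := by
  have hΦ := contDiff_uncurry_boxWeight (q := q) (r := r) hd₁ hd₂ hα hβ i
  have hΦc := hasCompactSupport_uncurry_boxWeight (q := q) (d₁ := d₁) (d₂ := d₂) (α := α) (β := β) (r := r) i
  have hA₁ := integral_norm_iteratedDeriv_boxWeight_le_cost (q := q) (r := r) hd₁ hd₂ hα hβ i k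
  have hA₁' := integral_norm_iteratedDeriv_boxWeight_le_cost (q := q) (r := r) hd₁ hd₂ hα hβ i (2 * k)
  have hA₂ := integral_norm_iteratedDeriv_boxWeight_snd_le_cost (q := q) (r := r) hd₁ hd₂ hα hβ i 4
  have hsum : ∀ m : ℕ, 0 ≤ ∑ j ∈ Finset.range (m + 1), ((m : ℕ).choose j : ℝ) * (2 ^ j * dyadicBumpBound j) *
      ((((m - j : ℕ) : ℝ) + 1) ^ 2 * (m - j) ! * ((m - j : ℕ) : ℝ) ^ (m - j)) := fun m =>
    Finset.sum_nonneg fun j _ => by have := dyadicBumpBound_nonneg j; positivity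
  have hr1 : 0 ≤ ((d₁ : ℝ) * d₂ * (2 ^ i.2 / 2)) ^ (-(1 : ℝ) / 2) := Real.rpow_nonneg (by positivity) _
  have hr2 : 0 ≤ ((2 : ℝ) ^ i.1 / 2) ^ (-(1 : ℝ) / 2) := Real.rpow_nonneg (by positivity) _
  have hS₁ : ∀ m : ℕ, 0 ≤ ((3 * 2 ^ i.2 / 2) * (3 * 2 ^ i.1 / 2) *
            (∑ j ∈ Finset.range (m + 1), ((m : ℕ).choose j : ℝ) * (2 ^ j * dyadicBumpBound j) *
              ((((m - j : ℕ) : ℝ) + 1) ^ 2 * (m - j) ! * ((m - j : ℕ) : ℝ) ^ (m - j))) *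
            (((d₁ : ℝ) * d₂ * (2 ^ i.2 / 2)) ^ (-(1 : ℝ) / 2) * (r : ℝ)⁻¹ * ((2 : ℝ) ^ i.1 / 2) ^ (-(1 : ℝ) / 2))) := by
    intro m
    have := hsum m
    positivity
  have hD₁ : 0 ≤ ((1 + 4 * π * Real.sqrt ((α : ℝ) * β * (2 * 2 ^ i.2)) / ((q : ℝ) * r) * Real.sqrt (2 * 2 ^ i.1)) /
            ((2 : ℝ) ^ i.1 / 2)) := by positivity
  exact tsum_tail_norm_fourier2_le_pure_of_cost hΦ hΦc hc hk hH (hS₁ k) (hS₁ (2 * k)) hD₁ hQ hA₁ hA₁' hA₂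
    hlen


/-- **Bounded multiplicities** (`‖N(h)‖ ≤ N₀`, e.g. `N₀ = 1` on the coprime stratum, `N₀ = qr` always): the
truncated weighted dual sum of one box. [folklore] -/
theorem tsum_tail_norm_fourier2_boxWeight_mul_le [NeZero q] (hd₁ : 1 ≤ d₁) (hd₂ : 1 ≤ d₂) (hα : 1 ≤ α)
    (hβ : 1 ≤ β) (i : ℕ × ℕ) {c : ℝ} (hc : 0 < c) {k H : ℕ} (hk : 2 ≤ k) (hH : 1 ≤ H) {Q : ℝ} (hQ : 1 ≤ Q)
    (hlen : c * ((1 + 4 * π * Real.sqrt ((α : ℝ) * β * (2 * 2 ^ i.2)) / ((q : ℝ) * r) * Real.sqrt (2 * 2 ^ i.1)) /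
            ((2 : ℝ) ^ i.1 / 2)) / (2 * π) * Q ≤ H) {N : ℤ × ℤ → ℂ} {N₀ : ℝ} (hN : ∀ h, ‖N h‖ ≤ N₀) :
    ∑' h : ℤ × ℤ, (if (H : ℤ) < |h.1| then
        ‖fourier2 (boxWeight q d₁ d₂ α β r i) (h.1 / c) (h.2 / c) * N h‖ else 0) ≤
      2 * (((3 * 2 ^ i.2 / 2) * (3 * 2 ^ i.1 / 2) *
            (∑ j ∈ Finset.range (k + 1), ((k : ℕ).choose j : ℝ) * (2 ^ j * dyadicBumpBound j) *
              ((((k - j : ℕ) : ℝ) + 1) ^ 2 * (k - j) ! * ((k - j : ℕ) : ℝ) ^ (k - j))) *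
            (((d₁ : ℝ) * d₂ * (2 ^ i.2 / 2)) ^ (-(1 : ℝ) / 2) * (r : ℝ)⁻¹ * ((2 : ℝ) ^ i.1 / 2) ^ (-(1 : ℝ) / 2))) +
          π ^ 2 / 3 * (c * ((1 + 4 * π * Real.sqrt ((β : ℝ) * α * (2 * 2 ^ i.1)) / ((q : ℝ) * r) * Real.sqrt (2 * 2 ^ i.2)) /
            ((2 : ℝ) ^ i.2 / 2)) / (2 * π)) ^ 2 *
            Real.sqrt (((3 * 2 ^ i.2 / 2) * (3 * 2 ^ i.1 / 2) *
            (∑ j ∈ Finset.range ((2 * k) + 1), (((2 * k) : ℕ).choose j : ℝ) * (2 ^ j * dyadicBumpBound j) *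
              (((((2 * k) - j : ℕ) : ℝ) + 1) ^ 2 * ((2 * k) - j) ! * (((2 * k) - j : ℕ) : ℝ) ^ ((2 * k) - j))) *
            (((d₁ : ℝ) * d₂ * (2 ^ i.2 / 2)) ^ (-(1 : ℝ) / 2) * (r : ℝ)⁻¹ * ((2 : ℝ) ^ i.1 / 2) ^ (-(1 : ℝ) / 2))) *
              ((3 * 2 ^ i.1 / 2) * (3 * 2 ^ i.2 / 2) *
            (∑ j ∈ Finset.range (4 + 1), ((4 : ℕ).choose j : ℝ) * (2 ^ j * dyadicBumpBound j) *
              ((((4 - j : ℕ) : ℝ) + 1) ^ 2 * (4 - j) ! * ((4 - j : ℕ) : ℝ) ^ (4 - j))) *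
            (((d₂ : ℝ) * d₁ * (2 ^ i.1 / 2)) ^ (-(1 : ℝ) / 2) * (r : ℝ)⁻¹ * ((2 : ℝ) ^ i.2 / 2) ^ (-(1 : ℝ) / 2))))) * H * (Q ^ k)⁻¹ * N₀ := by
  classical
  have hΦ := contDiff_uncurry_boxWeight (q := q) (r := r) hd₁ hd₂ hα hβ i
  have hΦc := hasCompactSupport_uncurry_boxWeight (q := q) (d₁ := d₁) (d₂ := d₂) (α := α) (β := β) (r := r) i
  have hmain := tsum_tail_norm_fourier2_boxWeight_le (r := r) hd₁ hd₂ hα hβ i hc hk hH hQ hlen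
  have hN0 : 0 ≤ N₀ := (norm_nonneg _).trans (hN 0)
  have hpt : ∀ h : ℤ × ℤ, (if (H : ℤ) < |h.1| then
      ‖fourier2 (boxWeight q d₁ d₂ α β r i) (h.1 / c) (h.2 / c) * N h‖ else 0) ≤
      (if (H : ℤ) < |h.1| then ‖fourier2 (boxWeight q d₁ d₂ α β r i) (h.1 / c) (h.2 / c)‖ else 0) * N₀ := by
    intro h
    split_ifs
    · rw [norm_mul]; exact mul_le_mul_of_nonneg_left (hN h) (norm_nonneg _)
    · rw [zero_mul]
  have hs₁ : Summable fun h : ℤ × ℤ =>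
      (if (H : ℤ) < |h.1| then ‖fourier2 (boxWeight q d₁ d₂ α β r i) (h.1 / c) (h.2 / c)‖ else 0) * N₀ :=
    (summable_tail_norm_fourier2 hΦ hΦc hc H).mul_right N₀
  have hs₀ : Summable fun h : ℤ × ℤ => (if (H : ℤ) < |h.1| then
      ‖fourier2 (boxWeight q d₁ d₂ α β r i) (h.1 / c) (h.2 / c) * N h‖ else 0) :=
    Summable.of_nonneg_of_le (fun h => by split_ifs <;> positivity) hpt hs₁
  calc _ ≤ ∑' h : ℤ × ℤ, (if (H : ℤ) < |h.1| then
          ‖fourier2 (boxWeight q d₁ d₂ α β r i) (h.1 / c) (h.2 / c)‖ else 0) * N₀ := hs₀.tsum_le_tsum hpt hs₁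
    _ = (∑' h : ℤ × ℤ, (if (H : ℤ) < |h.1| then
          ‖fourier2 (boxWeight q d₁ d₂ α β r i) (h.1 / c) (h.2 / c)‖ else 0)) * N₀ := tsum_mul_right
    _ ≤ _ := mul_le_mul_of_nonneg_right hmain hN0

/-- **The `h₂`-direction** (transposition + `boxWeight_swap`): for `H ≥ c·D₂·Q/(2π)` the tail `|h₂| > H` of the
dual sum of `Φ_i` obeys the swapped bound. [folklore] -/
theorem tsum_tail_snd_norm_fourier2_boxWeight_le [NeZero q] (hd₁ : 1 ≤ d₁) (hd₂ : 1 ≤ d₂) (hα : 1 ≤ α)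
    (hβ : 1 ≤ β) (i : ℕ × ℕ) {c : ℝ} (hc : 0 < c) {k H : ℕ} (hk : 2 ≤ k) (hH : 1 ≤ H) {Q : ℝ} (hQ : 1 ≤ Q)
    (hlen : c * ((1 + 4 * π * Real.sqrt ((β : ℝ) * α * (2 * 2 ^ i.1)) / ((q : ℝ) * r) * Real.sqrt (2 * 2 ^ i.2)) /
            ((2 : ℝ) ^ i.2 / 2)) / (2 * π) * Q ≤ H) :
    ∑' h : ℤ × ℤ, (if (H : ℤ) < |h.2| then
        ‖fourier2 (boxWeight q d₁ d₂ α β r i) (h.1 / c) (h.2 / c)‖ else 0) ≤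
      2 * (((3 * 2 ^ i.1 / 2) * (3 * 2 ^ i.2 / 2) *
            (∑ j ∈ Finset.range (k + 1), ((k : ℕ).choose j : ℝ) * (2 ^ j * dyadicBumpBound j) *
              ((((k - j : ℕ) : ℝ) + 1) ^ 2 * (k - j) ! * ((k - j : ℕ) : ℝ) ^ (k - j))) *
            (((d₂ : ℝ) * d₁ * (2 ^ i.1 / 2)) ^ (-(1 : ℝ) / 2) * (r : ℝ)⁻¹ * ((2 : ℝ) ^ i.2 / 2) ^ (-(1 : ℝ) / 2))) +
          π ^ 2 / 3 * (c * ((1 + 4 * π * Real.sqrt ((α : ℝ) * β * (2 * 2 ^ i.2)) / ((q : ℝ) * r) * Real.sqrt (2 * 2 ^ i.1)) /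
            ((2 : ℝ) ^ i.1 / 2)) / (2 * π)) ^ 2 *
            Real.sqrt (((3 * 2 ^ i.1 / 2) * (3 * 2 ^ i.2 / 2) *
            (∑ j ∈ Finset.range ((2 * k) + 1), (((2 * k) : ℕ).choose j : ℝ) * (2 ^ j * dyadicBumpBound j) *
              (((((2 * k) - j : ℕ) : ℝ) + 1) ^ 2 * ((2 * k) - j) ! * (((2 * k) - j : ℕ) : ℝ) ^ ((2 * k) - j))) *
            (((d₂ : ℝ) * d₁ * (2 ^ i.1 / 2)) ^ (-(1 : ℝ) / 2) * (r : ℝ)⁻¹ * ((2 : ℝ) ^ i.2 / 2) ^ (-(1 : ℝ) / 2))) *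
              ((3 * 2 ^ i.2 / 2) * (3 * 2 ^ i.1 / 2) *
            (∑ j ∈ Finset.range (4 + 1), ((4 : ℕ).choose j : ℝ) * (2 ^ j * dyadicBumpBound j) *
              ((((4 - j : ℕ) : ℝ) + 1) ^ 2 * (4 - j) ! * ((4 - j : ℕ) : ℝ) ^ (4 - j))) *
            (((d₁ : ℝ) * d₂ * (2 ^ i.2 / 2)) ^ (-(1 : ℝ) / 2) * (r : ℝ)⁻¹ * ((2 : ℝ) ^ i.1 / 2) ^ (-(1 : ℝ) / 2))))) * H * (Q ^ k)⁻¹ := by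
  have hsw := tsum_tail_norm_fourier2_boxWeight_le (q := q) (r := r) hd₂ hd₁ hβ hα i.swap hc hk hH hQ
  simp only [Prod.fst_swap, Prod.snd_swap] at hsw
  have hmain := hsw hlen
  -- transpose: `Φ̂_i(ξ₁,ξ₂) = Φ̂_{i.swap}'(ξ₂,ξ₁)`
  have hΦ := contDiff_uncurry_boxWeight (q := q) (r := r) hd₁ hd₂ hα hβ i
  have hΦc := hasCompactSupport_uncurry_boxWeight (q := q) (d₁ := d₁) (d₂ := d₂) (α := α) (β := β) (r := r) i
  have htr : ∀ ξ₁ ξ₂ : ℝ, fourier2 (boxWeight q d₁ d₂ α β r i) ξ₁ ξ₂ =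
      fourier2 (boxWeight q d₂ d₁ β α r i.swap) ξ₂ ξ₁ := by
    intro ξ₁ ξ₂
    rw [← fourier2_transpose_of_contDiff hΦ hΦc ξ₁ ξ₂]
    congr 1
    funext t₂ t₁
    exact boxWeight_swap i t₁ t₂
  -- reindex the lattice by the swap
  rw [← (Equiv.prodComm ℤ ℤ).tsum_eq]
  refine le_of_eq_of_le ?_ hmain
  refine tsum_congr fun h => ?_
  simp only [Equiv.prodComm_apply, Prod.fst_swap, Prod.snd_swap, htr]

end Assembly

end Summit.Parity.GeneralizedHardyLittlewood.Theorems.BeyondDiagonalBeatsQuarter.OffDiagPoissonTwisted
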